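import Summits.QuantumAdvantage.QuantumAdvantage.Theorems.ParityDialB

/-! # ParityDial (C) — decomp-qadv lens-2 g27, part 3/3 (mechanical split of the node file `g27/ParityDial.lean` at the §6/§7 boundary;
content verbatim).  Content: §7 the ODD-length special class `IsOffsetCombLocal r` (window of radius `r` + the comb counts `E_b`, `O_b` = ones at
even / odd forward offset), the pieces `OffsetCombFail` / `OGlobalFail`, the comb counts of lens-1's odd universal input `xUO r` (`ecntOff_xUO`,
`ocntOff_xUO`: functions of the radius-1 window), ★ `offsetCombFail_six` (EVERY radius, weight 6, degree-free, via tree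
`LightConeWindowHard.xUO_universalHard`); §8 the two-sided node `lightFailOdd_iff`, ★★ `lightFail_iff_generic : LightFail D 7 ↔ PGlobalFail 1 D 7 ∧
OGlobalFail 1 D 7`, `closes₂` / `closes₂_const` (→ `ExactnessDial.NoPerfectTwo3` / `NoPerfectConst3` BY NAME).  See part A for the memo. -/

set_option linter.dupNamespace false
set_option linter.style.longLine false

noncomputable section
open scoped Classical

namespace Summit.QuantumAdvantage.QuantumAdvantage.Theorems.ParityDial
open Finset
open Literature.Computability.QuantumComplexity Literature.Computability.QuantumComplexity.RingHLF
open Literature.Computability.MetaComplexity Literature.Computability.MetaComplexity.Smolensky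
open Summit.QuantumAdvantage.AdviceFreeQNC0 (OddZeros)
open Summit.QuantumAdvantage.AdviceFreeQNC0.LightConeWindowHard
  (window window_apply dot2_eq_zero_of_pairing nxt_val prv_val xor3_eq_false_iff UniversalHard xUO xUO_universalHard oddZeros_xUO)
open Summit.QuantumAdvantage.QuantumAdvantage.Theorems.LightDial (wt wt_le_of_val_mem lightLosing LightFail)
open Summit.QuantumAdvantage.QuantumAdvantage.Theses.ExactnessDial (NoPerfectTwo3 NoPerfectConst3)

variable {n : ℕ}

/-! ## §7 ODD lengths: the OFFSET-COMB-LOCAL class and its degree-free death at weight 6 (every radius)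

On an odd ring the position parity is not a ring notion; the survivors there (`W_odd = 1 + 2E + O + EO + x_{b−1}`, the affine/quadratic comb
rules; g26 `num/Q-STRUCTURE.md`: perfect to weight 4, dead at 6) read the input through a bounded window and the two COMB COUNTS `E_b`, `O_b` =
number of ones at even / odd forward offset `(a − b) mod n` from `b` — rotation-covariant but `b`-DEPENDENT, so lens-1's window-universal inputs do
not obviously cover them.  They do: on an input made of SEPARATED ADJACENT PAIRS of ones — lens-1's odd universal input `xUO r` = ones
`{0,1, 2r+2,2r+3, 4r+6,4r+7}` (tree `LightConeWindowHard.xUO_universalHard`, every radius `r`, every odd `n ≥ 6r+9`) — a pair `{a, a+1}` contributes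
exactly one even forward offset to `E_b` unless `b = a+1` (offsets `n−1`, `0`, both even), so `E_b = 3 + [x_b ∧ x_{b−1}]` and `O_b = 6 − E_b` are
functions of the radius-1 WINDOW (`ecntOff_xUO`, `ocntOff_xUO`).  Hence every offset-comb-local rule coincides on `xUO r` with a plain window rule
and loses (`offsetCombFail_six`, all `r`; degree-free). -/

/-- forward ring offset of position `a` from position `i`, i.e. `(a − i) mod n`, written without `% n`. -/
def offs (a i : Fin n) : ℕ := if (i : ℕ) ≤ a then (a : ℕ) - i else (a : ℕ) + n - i

/-- `E_i(x)`: the number of ones of `x` at EVEN forward offset from `i` (the comb count of an odd ring). -/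
def ecntOff (i : Fin n) (x : Fin n → Bool) : ℕ := (univ.filter fun a : Fin n => x a = true ∧ offs a i % 2 = 0).card

/-- `O_i(x)`: the number of ones of `x` at ODD forward offset from `i`. -/
def ocntOff (i : Fin n) (x : Fin n → Bool) : ℕ := (univ.filter fun a : Fin n => x a = true ∧ offs a i % 2 = 1).card

/-- OFFSET-COMB-LOCAL strategies of radius `r` (the odd-length SPECIAL class; degree-free, any input-global advice allowed): on every input, two
positions with the same radius-`r` window and the same comb counts `E`, `O` get the same answer bit (a rule reading the counts only mod 3, or
any input-global advice, is a fortiori in the class). -/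
def IsOffsetCombLocal (r : ℕ) (P : Fin n → CubeFn (ZMod 3) n) : Prop :=
  ∀ x : Fin n → Bool, ∀ i j : Fin n, window r x i = window r x j → ecntOff i x = ecntOff j x →
    ocntOff i x = ocntOff j x → (P i x = 1 ↔ P j x = 1)

/-- non-vacuity: the comb count itself (the degree-1 rule `E_b mod 3`, building block of every comb rule) is offset-comb-local at every radius. -/
theorem isOffsetCombLocal_ecnt (r : ℕ) : IsOffsetCombLocal (n := n) r (fun i x => (ecntOff i x : ZMod 3)) := by
  intro x i j _ hE _
  simp only [hE]

/-- non-vacuity: so is every plain window rule (lens-1's class, with any advice). -/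
theorem isOffsetCombLocal_window (r : ℕ) (G : (Fin (2 * r + 1) → Bool) → ZMod 3) :
    IsOffsetCombLocal (n := n) r (fun i x => G (window r x i)) := by
  intro x i j hw _ _
  simp only [hw]

/-- SPECIAL PIECE, odd lengths: eventually in ODD `n`, every offset-comb-local strategy of radius `r` loses on an odd-class input of weight `≤ w`. -/
def OffsetCombFail (r w : ℕ) : Prop :=
  ∃ n₀ : ℕ, ∀ n ≥ n₀, n % 2 = 1 → ∀ P : Fin n → CubeFn (ZMod 3) n, IsOffsetCombLocal r P →
    ∃ x : Fin n → Bool, OddZeros x ∧ wt x ≤ w ∧ ¬ Rel x (fun i => decide (P i x = 1))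

/-- GENERIC PIECE, odd lengths (OPEN at `(1,2,7)`): eventually in ODD `n`, every degree-`≤ D` strategy that is NOT offset-comb-local of radius `r`
loses on an odd-class input of weight `≤ w`. -/
def OGlobalFail (r D w : ℕ) : Prop :=
  ∃ n₀ : ℕ, ∀ n ≥ n₀, n % 2 = 1 → ∀ P : Fin n → CubeFn (ZMod 3) n, (∀ i, P i ∈ lowDeg (ZMod 3) n D) → ¬ IsOffsetCombLocal r P →
    ∃ x : Fin n → Bool, OddZeros x ∧ wt x ≤ w ∧ ¬ Rel x (fun i => decide (P i x = 1))

/-- counting through a list: if the ones of `x` are listed by `L` (values `< n`, no duplicates) then a comb-type count is a filtered length. -/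
theorem card_filter_eq_length (x : Fin n → Bool) (L : List ℕ) (hL : ∀ a : Fin n, x a = true ↔ (a : ℕ) ∈ L)
    (hLn : ∀ t ∈ L, t < n) (hnd : L.Nodup) (q : ℕ → Bool) (Q : Fin n → Prop) [DecidablePred Q]
    (hQ : ∀ a : Fin n, Q a ↔ q a = true) :
    (univ.filter fun a : Fin n => x a = true ∧ Q a).card = (L.filter q).length := by
  have h : (univ.filter fun a : Fin n => x a = true ∧ Q a)
      = (L.filter q).toFinset.attachFin (fun t ht => hLn t (List.mem_filter.mp (List.mem_toFinset.mp ht)).1) := by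
    ext a
    simp only [mem_filter, mem_univ, true_and, mem_attachFin, List.mem_toFinset, List.mem_filter, hL, hQ]
  rw [h, card_attachFin, List.toFinset_card_of_nodup (hnd.filter q)]

/-- the ones of `xUO r n`, as a list. -/
theorem xUO_mem_list (r : ℕ) (a : Fin n) :
    xUO r n a = true ↔ (a : ℕ) ∈ [0, 1, 2 * r + 2, 2 * r + 3, 4 * r + 6, 4 * r + 7] := by
  simp only [xUO, decide_eq_true_eq, List.mem_cons, List.not_mem_nil, or_false]

/-- that list has no duplicates. -/
theorem xUO_list_nodup (r : ℕ) : ([0, 1, 2 * r + 2, 2 * r + 3, 4 * r + 6, 4 * r + 7] : List ℕ).Nodup := by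
  refine List.nodup_cons.mpr ⟨?_, List.nodup_cons.mpr ⟨?_, List.nodup_cons.mpr ⟨?_, List.nodup_cons.mpr ⟨?_,
    List.nodup_cons.mpr ⟨?_, List.nodup_singleton _⟩⟩⟩⟩⟩ <;>
    simp only [List.mem_cons, List.not_mem_nil, or_false, not_or] <;> omega

/-- the parity-of-forward-offset test, as an `if`-free Boolean predicate on naturals (`e = 0`: even offset, `e = 1`: odd). -/
def offq (i n e t : ℕ) : Bool := decide ((i ≤ t ∧ (t - i) % 2 = e) ∨ (t < i ∧ (t + n - i) % 2 = e))

/-- `offs` agrees with `offq`. -/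
theorem offs_iff_offq (e : ℕ) (a i : Fin n) : offs a i % 2 = e ↔ offq i n e a = true := by
  have ha := a.isLt
  have hi := i.isLt
  unfold offs offq
  rw [decide_eq_true_eq]
  split_ifs <;> omega

/-- one separated adjacent pair `{a, a+1}` contributes ONE even forward offset to every position except `a+1`, where it contributes two
(`n` odd: the offsets `n − 1` and `0` are both even). -/
theorem pair_filter_even (a i n : ℕ) (hn : n % 2 = 1) (hi : i < n) :
    (([a, a + 1] : List ℕ).filter (offq i n 0)).length = if i = a + 1 then 2 else 1 := by
  simp only [List.filter_cons, List.filter_nil, offq, decide_eq_true_eq]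
  split_ifs <;> first | rfl | (exfalso; omega)

/-- and ONE odd forward offset to every position except `a+1`, where it contributes none. -/
theorem pair_filter_odd (a i n : ℕ) (hn : n % 2 = 1) (hi : i < n) :
    (([a, a + 1] : List ℕ).filter (offq i n 1)).length = if i = a + 1 then 0 else 1 := by
  simp only [List.filter_cons, List.filter_nil, offq, decide_eq_true_eq]
  split_ifs <;> first | rfl | (exfalso; omega)

/-- the list of ones of `xUO r`, as three pairs. -/
theorem xUO_list_eq (r : ℕ) : ([0, 1, 2 * r + 2, 2 * r + 3, 4 * r + 6, 4 * r + 7] : List ℕ)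
    = [0, 0 + 1] ++ ([2 * r + 2, 2 * r + 2 + 1] ++ [4 * r + 6, 4 * r + 6 + 1]) := rfl

/-- ★ the EVEN comb count of `xUO r n` (`n` odd, `n ≥ 4r+8`): `3`, plus `1` exactly at the right elements `1, 2r+3, 4r+7` of the three pairs. -/
theorem ecntOff_xUO (r : ℕ) (hn : n % 2 = 1) (h : 4 * r + 8 ≤ n) (i : Fin n) :
    ecntOff i (xUO r n) = if (i : ℕ) = 1 ∨ (i : ℕ) = 2 * r + 3 ∨ (i : ℕ) = 4 * r + 7 then 4 else 3 := by
  have hi := i.isLt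
  unfold ecntOff
  rw [card_filter_eq_length (xUO r n) _ (xUO_mem_list r)
    (by intro t ht; simp only [List.mem_cons, List.not_mem_nil, or_false] at ht; omega)
    (xUO_list_nodup r) (offq i n 0) (fun a : Fin n => offs a i % 2 = 0) (fun a => offs_iff_offq 0 a i),
    xUO_list_eq, List.filter_append, List.filter_append, List.length_append, List.length_append,
    pair_filter_even 0 i n hn hi, pair_filter_even (2 * r + 2) i n hn hi, pair_filter_even (4 * r + 6) i n hn hi]
  split_ifs <;> omega

/-- ★ the ODD comb count of `xUO r n`: `3`, minus `1` exactly at the right elements. -/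
theorem ocntOff_xUO (r : ℕ) (hn : n % 2 = 1) (h : 4 * r + 8 ≤ n) (i : Fin n) :
    ocntOff i (xUO r n) = if (i : ℕ) = 1 ∨ (i : ℕ) = 2 * r + 3 ∨ (i : ℕ) = 4 * r + 7 then 2 else 3 := by
  have hi := i.isLt
  unfold ocntOff
  rw [card_filter_eq_length (xUO r n) _ (xUO_mem_list r)
    (by intro t ht; simp only [List.mem_cons, List.not_mem_nil, or_false] at ht; omega)
    (xUO_list_nodup r) (offq i n 1) (fun a : Fin n => offs a i % 2 = 1) (fun a => offs_iff_offq 1 a i),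
    xUO_list_eq, List.filter_append, List.filter_append, List.length_append, List.length_append,
    pair_filter_odd 0 i n hn hi, pair_filter_odd (2 * r + 2) i n hn hi, pair_filter_odd (4 * r + 6) i n hn hi]
  split_ifs <;> omega

/-- the right elements of the three pairs are exactly the positions `b` with `x_b = x_{b−1} = 1` (`r ≥ 1`, `n ≥ 4r+9`). -/
theorem xUO_right_iff (r : ℕ) (hr : 1 ≤ r) (h : 4 * r + 9 ≤ n) (i : Fin n) :
    ((i : ℕ) = 1 ∨ (i : ℕ) = 2 * r + 3 ∨ (i : ℕ) = 4 * r + 7) ↔ (xUO r n i = true ∧ xUO r n (prv i) = true) := by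
  have hi := i.isLt
  have hp := prv_val i
  simp only [xUO, decide_eq_true_eq]
  generalize ((prv i : Fin n) : ℕ) = p at *
  split_ifs at hp <;> omega

/-- the centre entry of the radius-`r` window is the bit itself. -/
theorem window_centre (r : ℕ) (hrn : r ≤ n) (x : Fin n → Bool) (i : Fin n) : window r x i ⟨r, by omega⟩ = x i := by
  have hi := i.isLt
  rw [window_apply r hrn]
  congr 1
  apply Fin.ext
  simp only
  split_ifs <;> omega

/-- the entry left of the centre is the predecessor bit (`r ≥ 1`). -/
theorem window_pred (r : ℕ) (hr : 1 ≤ r) (hrn : r ≤ n) (x : Fin n → Bool) (i : Fin n) :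
    window r x i ⟨r - 1, by omega⟩ = x (prv i) := by
  have hi := i.isLt
  rw [window_apply r hrn]
  congr 1
  apply Fin.ext
  rw [prv_val]
  simp only
  split_ifs <;> omega

/-- ★ ON `xUO r` EVERY OFFSET-COMB-LOCAL RULE IS A WINDOW RULE, HENCE LOSES (`r ≥ 1`, odd `n = 2k+1 ≥ 6r+9`; via lens-1's `xUO_universalHard`). -/
theorem not_rel_xUO_of_isOffsetCombLocal (r k : ℕ) (hr : 1 ≤ r) (hk : 3 * r + 4 ≤ k)
    {P : Fin (2 * k + 1) → CubeFn (ZMod 3) (2 * k + 1)} (hP : IsOffsetCombLocal r P) :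
    ¬ Rel (xUO r (2 * k + 1)) (fun i => decide (P i (xUO r (2 * k + 1)) = 1)) := by
  have hU := xUO_universalHard r k hk
  have hodd : (2 * k + 1) % 2 = 1 := by omega
  set F : (Fin (2 * r + 1) → Bool) → Bool := fun w =>
    if h : ∃ j : Fin (2 * k + 1), window r (xUO r (2 * k + 1)) j = w then decide (P h.choose (xUO r (2 * k + 1)) = 1) else false
    with hFdef
  have key : (fun i => decide (P i (xUO r (2 * k + 1)) = 1)) = fun i => F (window r (xUO r (2 * k + 1)) i) := by
    funext i
    have h : ∃ j : Fin (2 * k + 1), window r (xUO r (2 * k + 1)) j = window r (xUO r (2 * k + 1)) i := ⟨i, rfl⟩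
    simp only [hFdef, dif_pos h]
    have hw := h.choose_spec
    have hc : xUO r (2 * k + 1) h.choose = xUO r (2 * k + 1) i := by
      rw [← window_centre r (by omega) (xUO r _) h.choose, ← window_centre r (by omega) (xUO r _) i, hw]
    have hq : xUO r (2 * k + 1) (prv h.choose) = xUO r (2 * k + 1) (prv i) := by
      rw [← window_pred r hr (by omega) (xUO r _) h.choose, ← window_pred r hr (by omega) (xUO r _) i, hw]
    have hright : ((h.choose : ℕ) = 1 ∨ (h.choose : ℕ) = 2 * r + 3 ∨ (h.choose : ℕ) = 4 * r + 7) ↔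
        (((i : Fin (2 * k + 1)) : ℕ) = 1 ∨ (i : ℕ) = 2 * r + 3 ∨ (i : ℕ) = 4 * r + 7) := by
      rw [xUO_right_iff r hr (by omega), xUO_right_iff r hr (by omega), hc, hq]
    have hE : ecntOff h.choose (xUO r (2 * k + 1)) = ecntOff i (xUO r (2 * k + 1)) := by
      rw [ecntOff_xUO r hodd (by omega), ecntOff_xUO r hodd (by omega)]
      by_cases hc' : ((i : ℕ) = 1 ∨ (i : ℕ) = 2 * r + 3 ∨ (i : ℕ) = 4 * r + 7)
      · rw [if_pos hc', if_pos (hright.mpr hc')]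
      · rw [if_neg hc', if_neg (fun h' => hc' (hright.mp h'))]
    have hO : ocntOff h.choose (xUO r (2 * k + 1)) = ocntOff i (xUO r (2 * k + 1)) := by
      rw [ocntOff_xUO r hodd (by omega), ocntOff_xUO r hodd (by omega)]
      by_cases hc' : ((i : ℕ) = 1 ∨ (i : ℕ) = 2 * r + 3 ∨ (i : ℕ) = 4 * r + 7)
      · rw [if_pos hc', if_pos (hright.mpr hc')]
      · rw [if_neg hc', if_neg (fun h' => hc' (hright.mp h'))]
    rw [decide_eq_decide]
    exact (hP _ _ _ hw hE hO).symm
  rw [key]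
  exact hU.2 F

/-- ★★ THE ODD SPECIAL PIECE IS A THEOREM for every radius `r ≥ 1`, at weight 6 (and for every degree): `n₀ = 6r + 9`. -/
theorem offsetCombFail_six_of_pos (r : ℕ) (hr : 1 ≤ r) : OffsetCombFail r 6 := by
  refine ⟨6 * r + 9, fun n hn ho P hP => ?_⟩
  obtain ⟨k, rfl⟩ : ∃ k, n = 2 * k + 1 := ⟨n / 2, by omega⟩
  exact ⟨xUO r _, oddZeros_xUO r k (by omega), LightDial.wt_xUO r _, not_rel_xUO_of_isOffsetCombLocal r k hr (by omega) hP⟩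

/-- radius 0 is contained in radius 1 (a rule reading only `x_b` and the comb counts reads the radius-1 window a fortiori). -/
theorem isOffsetCombLocal_one_of_zero {P : Fin n → CubeFn (ZMod 3) n} (hP : IsOffsetCombLocal 0 P) : IsOffsetCombLocal 1 P := by
  intro x i j hw hE hO
  refine hP x i j ?_ hE hO
  have hi := i.isLt
  funext d
  have hd : d = ⟨0, by omega⟩ := Fin.ext (by have := d.isLt; omega)
  subst hd
  have h1 := window_centre 1 (by omega) x i
  have h2 := window_centre 1 (by omega) x j
  rw [hw] at h1
  rw [window_centre 0 (by omega) x i, window_centre 0 (by omega) x j, ← h1, h2]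

/-- ★★ THE ODD SPECIAL PIECE for EVERY radius (weight 6). -/
theorem offsetCombFail_six (r : ℕ) : OffsetCombFail r 6 := by
  rcases Nat.eq_zero_or_pos r with rfl | hr
  · obtain ⟨n₀, h₀⟩ := offsetCombFail_six_of_pos 1 le_rfl
    exact ⟨n₀, fun n hn ho P hP => h₀ n hn ho P (isOffsetCombLocal_one_of_zero hP)⟩
  · exact offsetCombFail_six_of_pos r hr

/-- monotonicity of the odd special piece in the weight. -/
theorem offsetCombFail_mono {r w w' : ℕ} (hw : w ≤ w') (h : OffsetCombFail r w) : OffsetCombFail r w' := by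
  obtain ⟨n₀, h₀⟩ := h
  refine ⟨n₀, fun n hn ho P hP => ?_⟩
  obtain ⟨x, hx, hxw, hR⟩ := h₀ n hn ho P hP
  exact ⟨x, hx, hxw.trans hw, hR⟩

/-! ## §8 The two-sided node: special classes closed on BOTH parities of the length -/

/-- gluing on odd lengths: special (weight 6 ≤ 7) + generic give the odd-length piece. -/
theorem lightFailOdd_of_pieces {r D w : ℕ} (hs : OffsetCombFail r w) (hg : OGlobalFail r D w) : LightFailOdd D w := by
  obtain ⟨n₁, h₁⟩ := hs
  obtain ⟨n₂, h₂⟩ := hg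
  refine ⟨n₁ + n₂, fun n hn ho => (LightDial.mem_lightLosing D w n).mpr fun P hP => ?_⟩
  by_cases hl : IsOffsetCombLocal r P
  · exact h₁ n (by omega) ho P hl
  · exact h₂ n (by omega) ho P hP hl

/-- exactness on odd lengths. -/
theorem opieces_of_lightFailOdd {r D w : ℕ} (h : LightFailOdd D w) : OGlobalFail r D w := by
  obtain ⟨n₀, h₀⟩ := h
  exact ⟨n₀, fun n hn ho P hP _ => (LightDial.mem_lightLosing D w n).mp (h₀ n hn ho) P hP⟩

/-- ★ ODD NODE (EQUIV, every degree `D`, every radius `r`): `LightFailOdd D 7 ⟺ OGlobalFail r D 7`. -/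
theorem lightFailOdd_iff (r D : ℕ) : LightFailOdd D 7 ↔ OGlobalFail r D 7 :=
  ⟨opieces_of_lightFailOdd, lightFailOdd_of_pieces (offsetCombFail_mono (by norm_num) (offsetCombFail_six r))⟩

/-- ★★ TWO-SIDED NODE (EQUIV, every degree `D`): `LightFail D 7 ⟺ PGlobalFail 1 D 7 ∧ OGlobalFail 1 D 7` — on both parities of the length the
structured (special) rules are OFF THE TABLE at weight 7 by degree-free theorems (`pLocalFail_one_seven`, `offsetCombFail_six`); the law-bet that
remains is about GENERIC quadratic strategies only: not parity-local (even `n`), not offset-comb-local (odd `n`). -/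
theorem lightFail_iff_generic (D : ℕ) : LightFail D 7 ↔ PGlobalFail 1 D 7 ∧ OGlobalFail 1 D 7 := by
  rw [lightFail_iff_pieces, lightFailOdd_iff 1]

/-- ★ `closes₂`: the two generic pieces give ExactnessDial's `NoPerfectTwo3` (stmt-QuantumAdvantage-27432) BY NAME. -/
theorem closes₂ (hg : PGlobalFail 1 2 7) (ho : OGlobalFail 1 2 7) : NoPerfectTwo3 :=
  LightDial.closes 7 ((lightFail_iff_generic 2).mpr ⟨hg, ho⟩)

/-- schematic form: generic pieces at every degree (weights `≥ 7`) give `NoPerfectConst3`. -/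
theorem closes₂_const (h : ∀ D, ∃ w, 7 ≤ w ∧ PGlobalFail 1 D w ∧ OGlobalFail 1 D w) : NoPerfectConst3 :=
  LightDial.closes_const fun D => by
    obtain ⟨w, hw, hg, ho⟩ := h D
    exact ⟨w, lightFail_of_pieces (pLocalFail_mono hw pLocalFail_one_seven) hg
      (lightFailOdd_of_pieces (offsetCombFail_mono (show 6 ≤ w by omega) (offsetCombFail_six 1)) ho)⟩


end Summit.QuantumAdvantage.QuantumAdvantage.Theorems.ParityDial
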